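import Summits.QuantumFields.YangMills.Theorems.BalabanUVNodesPortHRecordJoinToDoor
import Summits.QuantumFields.YangMills.Theorems.BalabanUVNodesK0V23Stub3RunwiseSuppliersAx

/-!
# LANDING NOTE (porter PTC-1 g3, `ymgap-nodeO-port-PTC-1`; ★ P3 g89's OFFER nodeO STATUS 2026-08-31T06:47:54Z «your pen on the K0ᴬ JOIN files — land below
# `--supports stmt-QuantumFields-27238 --as helper`, authorship ★ P3 g89»).  AUTHORSHIP = ★ P3 g89, HOME sketch `pub/ym-nodeO-ideate/nodeO-cover/P3-K0AxMomentDoor-v1.lean`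
# (d72d21419a39538f · 416 l. · 29 thm · 6 def; farm rc 0 · 0 err · 0 warn · 0 sorry at P3's desk 06:46Z).  LANDED AS TWO FILES (the sketch is 416 l. > the 400-line cap, and the
# gate lint `theses-cone` wants definitions outside the route file's import cone): THIS FILE `…K0AxMomentRoad.lean` = §1 (generic, rate-free analysis) + §2 (record letters
# `RecordPlimAbsMomentOnRunsAx` ∕ `RecordPvolAbsMomentOnRunsAx` and their order) + §4's two consequent shapes `JoinConclMomR` ∕ `JoinConclVolMomR` with their pure-letter
# comparisons — ROUTE-INDEPENDENT (imports ✓`…PortHRecordJoinToDoor` + ✓`…K0V23Stub3RunwiseSuppliersAx` only); the companion `…K0AxMomentDoor.lean` = §3 (doors (μ_cof)-Ax ∕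
# (μ_cof^vol)-Ax, K0ᴬ BY NAME) + the rest of §4 (token-free ∕ cut doors).  Declarations and proofs byte-identical to the sketch; P3's module docstring follows unchanged.
-/

/-!
# K0ᴬ — THE RATE-FREE DOOR: run-uniform ABSOLUTE SECOND MOMENTS of the record's limit activities suffice for K0ᴬ,
# and they are supplied from finite volumes by FATOU through finite windows (no decay rate anywhere on the supplier side)

LENS P3 «weaken the target» (ideation cell `ym-nodeO-ideate`, seat ★ P3 g89) applied AT the K0ᴬ door of `route-QuantumFields-BalabanUVNodes`
(K0ᴬ = `Summit.QuantumFields.YangMills.Theses.BalabanUVNodes.Record13SepCoPHInhabitedAx`, stmt-QuantumFields-27238, OPEN).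

WHAT THE DAG CONSUMES FROM NODE O AT K0ᴬ.  Every typed road to K0ᴬ in the tree ends in the run |β| letter of door (ρ_cof)-Ax
`K0V23Stub3CofinalRunDoorAx.K0RunCofinalRadiiAx`; the decay roads (W-UDR-Ax `K0PiDecayCofinalRadiiAx`, the JOIN road's `JoinConclLimR`) reach it through
`K0RecordFormatNames.runAbs_of_recordPlimDecayOnRunsAx`, whose ONLY use of the (5.10)-rate `δ₁` is `B12Sec2to5.secondMoment_abs_le_of_decay510`: dominated
summation of the (1.22)∕(5.42) series `β = Σ_z Π(z) z_0 z_1`.  ON THE BOX β IS that second moment (`betaOfRecord₁₃Ax_thetaFill_of_mem_box`).  Hence the weakest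
kernel-currency statement SHORT of (5.10)-decay that still feeds every K0ᴬ edge is a run-uniform bound on the ABSOLUTE second moment
`Σ_z |Π(z)|·|z_0|·|z_1| ≤ M` of the limit activities `recordPlimAx` along the record's own in-window runs, on cofinally small radii — door (μ_cof)-Ax below.

* §1 GENERIC (rate-free real analysis): ★ `summable_and_tsum_le_of_tendsto_of_frequently_sum_le` — FATOU THROUGH FINITE WINDOWS: pointwise limits of
  nonnegative families whose window-truncated sums are FREQUENTLY `≤ M` along finite windows exhausting the index set have summable limit with sum `≤ M`
  (finite partial sums + `IsClosed.mem_of_frequently_of_tendsto` + `summable_of_sum_le`); `summable_and_abs_secondMoment_le_tsum` — domination of the (1.22)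
  series by the absolute moment; `summable_absMoment_of_decay510` — (5.10) ⟹ absolute moment `≤ β′₅.₁₀ = betaPrime510 d C δ₁` (so the new letters sit BELOW the
  decay letters); `exists_finset_exhaustion_zd` + `exists_window_sum_le_of_eventually_le` — from POINTWISE-EVENTUAL domination by a summable majorant to a
  WINDOWED bound holding at EVERY volume (choice of thresholds; the window is built from the data, never prescribed).
* §2 RECORD LETTERS (Ax names of DEF-1's editions; runs driven by the RE-CENTRED β `betaOfRecord₁₃Ax F 2 (thetaFill F a₀ ε₂₉)`): (L-absmom)
  `RecordPlimAbsMomentOnRunsAx F a₀ ε₂₉ γ₀ M` (limit side) and (V-absmom) `RecordPvolAbsMomentOnRunsAx F a₀ ε₂₉ γ₀ M` (finite-volume side: per run prefix SOME finite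
  windows `W K` exhausting `ℤ⁴` in the inhabitable order `∀ z, ∀ᶠ K, z ∈ W K`, and FREQUENTLY in the volume `K` the truncated absolute moment of `recordPvolAx … K` is
  `≤ M` — NO all-`z` finite-volume letter, so the periodicity guard of `K0RecordFormatNamesDecay` (:131) is respected); the order lemmas
  (L-dec) ⟹ (L-absmom), (V-dec-ev) ⟹ (V-absmom), ★ (L-lim) ∧ (V-absmom) ⟹ (L-absmom) (Fatou, RATE-FREE), ★ (L-absmom) ⟹ the run |β| letter with `β′ := M`.
* §3 DOORS: (μ_cof)-Ax `K0AbsMomentCofinalRadiiAx` between W-UDR-Ax and (ρ_cof)-Ax (`k0AbsMomentCofinalRadiiAx_of_k0PiDecayCofinalRadiiAx`,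
  `k0RunCofinalRadiiAx_of_k0AbsMomentCofinalRadiiAx`), ★★★ `record13SepCoPHInhabitedAx_of_k0AbsMomentCofinalRadiiAx` (K0ᴬ BY NAME), and the finite-volume door
  ★★★ `record13SepCoPHInhabitedAx_of_k0PvolAbsMomentCofinalRadiiAx` ((1.21) pointwise + windowed absolute moments, cofinal radii ⟹ K0ᴬ; no `C·e^{−δ₁|z|}` anywhere).
* §4 THE JOIN ROAD's MOMENT TWINS: `JoinConclMomR Tok F` (▶ PTC-1's `JoinConclLimR` with the consequent `(1.21) ∧ (5.10)-decay` replaced by (L-absmom) alone) and the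
  finite-volume `JoinConclVolMomR Tok F` ((L-lim) ∧ (V-absmom)); order `joinConclMomR_of_joinConclLimR` ∕ `_of_joinConclVolMomR` ∕ `_antitone_tok` ∕ `_of_tokFree`,
  `joinConclVolMomR_of_polLimit_pvolDecayEv` (`K0AxJoinResidualSplit` §7a's joint frame ⟹ the finite-volume moment-join); doors `k0AbsMomentCofinalRadiiAx_of_mom_cofinalRadii`,
  ★ `record13SepCoPHInhabitedAx_of_momCut` ∕ `_of_volMomCut` ∕ `_of_limCut_via_absMoment` ∕ `_of_polLimit_pvolDecayEv_cut_via_absMoment` ∕ `_of_mom_tokFree_anySupply`, and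
  ★★★ `record13SepCoPHInhabitedAx_of_mom_residual_tokFree` (`(∀ F, JoinConclMomR ⊤ F)` ∧ (R-Uk) ∧ (R-Bg) ⟹ K0ᴬ — the TOKEN-FREE, RATE-FREE door on the JOIN road; binders of
  (R-Uk) ∕ (R-Bg) VERBATIM from `K0AxJoinResidual` §5).  Every g88 ∕ ▶ PTC-1 decay door FACTORS through the moment doors (the `_via_absMoment` theorems).

LENS-P3 READING (edges fed ∕ broken).  FED: every K0ᴬ edge (the run |β| letter is all K0ᴬ's body `k0BodyAx_of_k0RunCofinalRadiiAx` reads).  NOT FED by (L-absmom): nothing —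
K1ᴬ∕K3ᴬ never read NODE O's kernel decay (they read run rows ∕ the (1.21) window letter).  WHAT THE WEAKENING BUYS: the supplier side needs NO rate: a port text proving, per
volume, a bound on the window-truncated absolute second moment of the finite-volume activities (any windows exhausting `ℤ⁴`, frequently in the volume) + the (1.21) limit
pointwise closes the door; (4.37)-type exponential decay is sufficient (§2 `recordPvolAbsMomentOnRunsAx_of_pvolDecayEv`) but not necessary.

HONEST FRAMING (binding).  CONDITIONAL helpers: kernel-checked implications HYPOTHESES ⟹ K0ᴬ BY NAME whose hypotheses — (L-absmom) ∕ (V-absmom) ∕ (L-lim) ∕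
`JoinConclMomR ⊤` ∕ (R-Uk) ∕ (R-Bg) — are OPEN Bałaban-strength content ([I] (1.21)–(1.22), (4.37), (5.10) in moment form) and P0 at the record, inhabited nowhere in the
tree; nothing of Bałaban's [I] ∕ [15] ∕ [16] is asserted, valued, ported, discharged or refuted here; typed ≠ proved; K0ᴬ stmt-QuantumFields-27238 OPEN (not claimed);
K1ᴬ 27239 ∕ K3ᴬ 27247 OPEN; NODE O `ExistsUniformAcrossSmall` 0∕1; COUNT 8∕28 · K 1∕4 UNMOVED; R4 = the CONDITIONAL finite-𝕋⁴ rung `BalabanLadder.UV` at fixed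
`ε = L^(−K)` — NOT continuum ∕ ℝ⁴ ∕ OS; **the Yang–Mills mass gap (Clay) is NOT proved by any of this.**  No `sorry` ∕ `instance` ∕ `notation`.
[I] = [Balaban1987RG1]; [15] = [Balaban1985Variational]; [16] = [Balaban1985BackgroundPropagators].
-/

noncomputable section

open scoped BigOperators Matrix.Norms.L2Operator Topology
open Set Filter

namespace Summit.QuantumFields.YangMills.Theorems.K0AxMomentRoad

open Summit.QuantumFields.YangMills.Theorems.K0RecordFormatNames
open Summit.QuantumFields.YangMills.Theorems
open Summit.QuantumFields.YangMills.Theorems.PortHRecordJoin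
open Literature.MathematicalPhysics.QuantumFieldTheory.Balaban1983to89
open Literature.MathematicalPhysics.QuantumFieldTheory.Balaban1983to89.Node00
open Literature.MathematicalPhysics.QuantumFieldTheory.Balaban1983to89.T4Continuum (T4Family)
open Literature.MathematicalPhysics.QuantumFieldTheory.Balaban1983to89.FlowStep
open Literature.MathematicalPhysics.QuantumFieldTheory.Balaban1983to89.FlowStepRuns
open Literature.MathematicalPhysics.QuantumFieldTheory.Balaban1983to89.B12Sec2to5 (l1 l1_nonneg abs_coord_le_l1 Decay510 betaPrime510 majorant_summable)

/-! ## §1  GENERIC, RATE-FREE: Fatou through finite windows; domination of the (1.22) series; (5.10) ⟹ absolute moment; windows from pointwise-eventual bounds -/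

section Generic

/-- ★ **FATOU THROUGH FINITE WINDOWS (rate-free).**  `f K → g` pointwise, `f, g ≥ 0`, finite windows `W K` exhausting the index set in the inhabitable order
`∀ x, ∀ᶠ K, x ∈ W K`, and FREQUENTLY `Σ_{x ∈ W K} f K x ≤ M` ⟹ `g` summable with `Σ' g ≤ M` (every finite partial sum of `g` is a limit of eventually-dominated
truncated sums; `IsClosed.mem_of_frequently_of_tendsto`, `summable_of_sum_le`, `Real.tsum_le_of_sum_le`). [folklore] -/
theorem summable_and_tsum_le_of_tendsto_of_frequently_sum_le {X κ : Type*} {l : Filter κ} {f : κ → X → ℝ} {g : X → ℝ}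
    (hg : ∀ x, 0 ≤ g x) (hf : ∀ K x, 0 ≤ f K x) (hlim : ∀ x, Tendsto (fun K => f K x) l (𝓝 (g x)))
    {W : κ → Finset X} (hW : ∀ x, ∀ᶠ K in l, x ∈ W K) {M : ℝ} (hM : ∃ᶠ K in l, ∑ x ∈ W K, f K x ≤ M) :
    Summable g ∧ ∑' x, g x ≤ M := by
  have hfin : ∀ S : Finset X, ∑ x ∈ S, g x ≤ M := by
    intro S
    have hSW : ∀ᶠ K in l, ∀ x ∈ S, x ∈ W K := (eventually_all_finset S).2 fun x _ => hW x
    have hfr : ∃ᶠ K in l, ∑ x ∈ S, f K x ≤ M :=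
      (hM.and_eventually hSW).mono fun K hK =>
        (Finset.sum_le_sum_of_subset_of_nonneg (fun x hx => hK.2 x hx) fun x _ _ => hf K x).trans hK.1
    have ht : Tendsto (fun K => ∑ x ∈ S, f K x) l (𝓝 (∑ x ∈ S, g x)) := tendsto_finsetSum S fun x _ => hlim x
    exact isClosed_Iic.mem_of_frequently_of_tendsto hfr ht
  exact ⟨summable_of_sum_le (fun x => hg x) hfin, Real.tsum_le_of_sum_le (fun x => hg x) hfin⟩

variable {d : ℕ}

/-- The absolute `(μ, ν)`-moment terms are nonnegative. [folklore] -/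
theorem absMomentTerm_nonneg (P : (Fin d → ℤ) → ℝ) (μ ν : Fin d) (x : Fin d → ℤ) : 0 ≤ |P x| * |(x μ : ℝ)| * |(x ν : ℝ)| :=
  mul_nonneg (mul_nonneg (abs_nonneg _) (abs_nonneg _)) (abs_nonneg _)

/-- **DOMINATION OF THE (1.22)∕(5.42) SERIES**: if the absolute `(μ, ν)`-moment of a kernel is summable, the second-moment series converges absolutely and
`|Σ_x Π_{μν}(x) x_μ x_ν| ≤ Σ_x |Π_{μν}(x)|·|x_μ|·|x_ν|`. [cite: Balaban1987RG1, (1.22) p.264, (5.42) p.297] -/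
theorem summable_and_abs_secondMoment_le_tsum {P : B12Beta.Kernel d} {μ ν : Fin d}
    (h : Summable fun x : Fin d → ℤ => |P μ ν x| * |(x μ : ℝ)| * |(x ν : ℝ)|) :
    Summable (fun x : Fin d → ℤ => P μ ν x * (x μ : ℝ) * (x ν : ℝ)) ∧
      |B12Beta.secondMoment P μ ν| ≤ ∑' x : Fin d → ℤ, |P μ ν x| * |(x μ : ℝ)| * |(x ν : ℝ)| := by
  have habs : ∀ x : Fin d → ℤ, ‖P μ ν x * (x μ : ℝ) * (x ν : ℝ)‖ = |P μ ν x| * |(x μ : ℝ)| * |(x ν : ℝ)| := fun x => by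
    rw [Real.norm_eq_abs, abs_mul, abs_mul]
  have hn : Summable fun x : Fin d → ℤ => ‖P μ ν x * (x μ : ℝ) * (x ν : ℝ)‖ := h.congr fun x => (habs x).symm
  refine ⟨hn.of_norm, ?_⟩
  have h1 := norm_tsum_le_tsum_norm hn
  rw [Real.norm_eq_abs, tsum_congr habs] at h1
  exact h1

/-- Pointwise: `|p| ≤ C·e^{−δ₁|x|₁}` ⟹ `|p|·|x_μ|·|x_ν| ≤ C·(|x|₁² e^{−δ₁|x|₁})`. [folklore] -/
theorem absMomentTerm_le_of_abs_le {p C δ₁ : ℝ} {x : Fin d → ℤ} (h : |p| ≤ C * Real.exp (-δ₁ * l1 x)) (μ ν : Fin d) :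
    |p| * |(x μ : ℝ)| * |(x ν : ℝ)| ≤ C * (l1 x ^ 2 * Real.exp (-δ₁ * l1 x)) := by
  have h2 := abs_coord_le_l1 x μ
  have h3 := abs_coord_le_l1 x ν
  have hCe : 0 ≤ C * Real.exp (-δ₁ * l1 x) := le_trans (abs_nonneg _) h
  calc |p| * |(x μ : ℝ)| * |(x ν : ℝ)| ≤ (C * Real.exp (-δ₁ * l1 x)) * l1 x * l1 x :=
        mul_le_mul (mul_le_mul h h2 (abs_nonneg _) hCe) h3 (abs_nonneg _) (mul_nonneg hCe (l1_nonneg x))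
    _ = C * (l1 x ^ 2 * Real.exp (-δ₁ * l1 x)) := by ring

/-- **(5.10) ⟹ ABSOLUTE MOMENT** (the content of `B12Sec2to5.secondMoment_abs_le_of_decay510`, one step earlier): `Decay510 P C δ₁`, `δ₁ > 0` ⟹ the absolute
`(μ, ν)`-moment is summable and `≤ β′₅.₁₀ = betaPrime510 d C δ₁`.  So every absolute-moment letter below sits BELOW the corresponding decay letter.
[cite: Balaban1987RG1, (5.10) p.293, (5.42) p.297] -/
theorem summable_absMoment_of_decay510 {P : (Fin d → ℤ) → ℝ} {C δ₁ : ℝ} (hδ : 0 < δ₁) (h : Decay510 P C δ₁) (μ ν : Fin d) :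
    Summable (fun x : Fin d → ℤ => |P x| * |(x μ : ℝ)| * |(x ν : ℝ)|) ∧
      ∑' x : Fin d → ℤ, |P x| * |(x μ : ℝ)| * |(x ν : ℝ)| ≤ betaPrime510 d C δ₁ := by
  have hS := (majorant_summable hδ d).mul_left C
  have hpt : ∀ x : Fin d → ℤ, |P x| * |(x μ : ℝ)| * |(x ν : ℝ)| ≤ C * (l1 x ^ 2 * Real.exp (-δ₁ * l1 x)) :=
    fun x => absMomentTerm_le_of_abs_le (h x) μ ν
  have hsum : Summable fun x : Fin d → ℤ => |P x| * |(x μ : ℝ)| * |(x ν : ℝ)| :=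
    Summable.of_nonneg_of_le (absMomentTerm_nonneg P μ ν) hpt hS
  refine ⟨hsum, (hsum.tsum_le_tsum hpt hS).trans_eq ?_⟩
  rw [tsum_mul_left]
  rfl

/-- `ℤᵈ` is exhausted by the finite boxes `[−K, K]ᵈ` along `atTop`. [folklore] -/
theorem exists_finset_exhaustion_zd (d : ℕ) : ∃ V : ℕ → Finset (Fin d → ℤ), ∀ x, ∀ᶠ K in atTop, x ∈ V K := by
  refine ⟨fun K => Fintype.piFinset fun _ : Fin d => Finset.Icc (-(K : ℤ)) K, fun x => ?_⟩
  refine (eventually_ge_atTop (∑ i, (x i).natAbs)).mono fun K hK => ?_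
  refine Fintype.mem_piFinset.2 fun i => Finset.mem_Icc.2 ?_
  have hi : (x i).natAbs ≤ K := (Finset.single_le_sum (fun j _ => Nat.zero_le _) (Finset.mem_univ i)).trans hK
  have habs : |x i| ≤ (K : ℤ) := by rw [Int.abs_eq_natAbs]; exact_mod_cast hi
  exact abs_le.1 habs

/-- **FROM POINTWISE-EVENTUAL DOMINATION TO WINDOWS** (rate-free bookkeeping): if `∀ x, ∀ᶠ K, f K x ≤ m x` with `m ≥ 0` summable, and the index set has finite
windows exhausting it along `atTop`, then SOME exhausting windows `W K` carry `Σ_{x ∈ W K} f K x ≤ Σ' m` at EVERY `K` (the window at `K` keeps the points whose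
threshold is `≤ K`; chosen from the data, never prescribed). [folklore] -/
theorem exists_window_sum_le_of_eventually_le {X : Type*} {f : ℕ → X → ℝ} {m : X → ℝ} (V : ℕ → Finset X) (hV : ∀ x, ∀ᶠ K in atTop, x ∈ V K)
    (hev : ∀ x, ∀ᶠ K in atTop, f K x ≤ m x) (hm : ∀ x, 0 ≤ m x) (hms : Summable m) :
    ∃ W : ℕ → Finset X, (∀ x, ∀ᶠ K in atTop, x ∈ W K) ∧ ∀ K, ∑ x ∈ W K, f K x ≤ ∑' x, m x := by
  choose N hN using fun x => eventually_atTop.1 (hev x)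
  refine ⟨fun K => (V K).filter fun x => N x ≤ K, fun x => ?_, fun K => ?_⟩
  · exact ((hV x).and (eventually_ge_atTop (N x))).mono fun K hK => Finset.mem_filter.2 hK
  · calc ∑ x ∈ (V K).filter (fun x => N x ≤ K), f K x ≤ ∑ x ∈ (V K).filter (fun x => N x ≤ K), m x :=
          Finset.sum_le_sum fun x hx => hN x K (Finset.mem_filter.1 hx).2
      _ ≤ ∑' x, m x := hms.sum_le_tsum _ fun x _ => hm x

end Generic

/-! ## §2  RECORD LETTERS (Ax names): the absolute-second-moment receipts along runs, limit side and finite-volume side, and their order -/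

variable (F : T4Family) (a₀ ε₂₉ : ℝ)

/-- **(L-absmom) — RECEIPT «RUN-UNIFORM ABSOLUTE SECOND MOMENT OF THE LIMIT ACTIVITIES AT THE RECORD»**: along every in-interval solution of (0.20) driven by the
record's own RE-CENTRED β up to `n`, for every `k ≤ n`, the absolute `(0, 1)`-moment of the LIMIT kernel `recordPlimAx F a₀ ε₂₉ k (prefixOf gs k)` is summable and
`≤ M` — ONE `M` for all runs and steps.  Strictly between the (5.10)-decay receipt `RecordPlimDecayOnRunsAx` and the run |β| letter; names THE record's kernel.
(HYPOTHESIS SHAPE — bookkeeping over accepted tree names, NOT a published result as typed; open.) [cite: Balaban1987RG1, (0.20) p.256, (1.21)–(1.22) p.264, (5.42) p.297, Thm 3 p.264 («uniformly bounded»)] -/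
def RecordPlimAbsMomentOnRunsAx (γ₀ M : ℝ) : Prop :=
  ∀ (n : ℕ) (gs : ℕ → ℝ), RGEqH n (betaOfRecord₁₃Ax F 2 (thetaFill F a₀ ε₂₉)) gs → Step.InInterval γ₀ n gs → ∀ k, k ≤ n →
    Summable (fun z : Fin 4 → ℤ => |recordPlimAx F a₀ ε₂₉ k (prefixOf gs k) 0 1 z| * |(z 0 : ℝ)| * |(z 1 : ℝ)|) ∧
      ∑' z : Fin 4 → ℤ, |recordPlimAx F a₀ ε₂₉ k (prefixOf gs k) 0 1 z| * |(z 0 : ℝ)| * |(z 1 : ℝ)| ≤ M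

/-- **(V-absmom) — RECEIPT «WINDOWED ABSOLUTE SECOND MOMENTS PER VOLUME, FREQUENTLY, ALONG RUNS, AT THE RECORD»**: at every run prefix SOME finite windows `W K ⊂ ℤ⁴`
exhausting `ℤ⁴` in the inhabitable order `∀ z, ∀ᶠ K, z ∈ W K`, such that FREQUENTLY in the volume `K` the window-truncated absolute `(0, 1)`-moment of the
FINITE-VOLUME kernel `recordPvolAx … K` is `≤ M`.  NO all-`z` finite-volume letter (the finite-volume kernel is periodic in `z`; only truncated sums are asked), NO rate.
The shape a port text bounding `Σ_{z ∈ window} |Π_K(z)|·|z_0|·|z_1|` at ONE real coupling per volume delivers.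
(HYPOTHESIS SHAPE — bookkeeping over accepted tree names; open.) [cite: Balaban1987RG1, (0.20) p.256, (1.20)–(1.21) p.264, (4.37) p.291, (5.42) p.297] -/
def RecordPvolAbsMomentOnRunsAx (γ₀ M : ℝ) : Prop :=
  ∀ (n : ℕ) (gs : ℕ → ℝ), RGEqH n (betaOfRecord₁₃Ax F 2 (thetaFill F a₀ ε₂₉)) gs → Step.InInterval γ₀ n gs → ∀ k, k ≤ n →
    ∃ W : ℕ → Finset (Fin 4 → ℤ), (∀ z, ∀ᶠ K in atTop, z ∈ W K) ∧
      ∃ᶠ K in atTop, ∑ z ∈ W K, |recordPvolAx F a₀ ε₂₉ k (prefixOf gs k) K 0 1 z| * |(z 0 : ℝ)| * |(z 1 : ℝ)| ≤ M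

/-- **(L-dec) ⟹ (L-absmom)** with `M := β′₅.₁₀ = betaPrime510 4 C δ₁` (the new limit letter sits BELOW the decay letter). [cite: Balaban1987RG1, (5.10) p.293, (5.42) p.297] -/
theorem recordPlimAbsMomentOnRunsAx_of_decay {γ₀ C δ₁ : ℝ} (h : RecordPlimDecayOnRunsAx F a₀ ε₂₉ γ₀ C δ₁) :
    RecordPlimAbsMomentOnRunsAx F a₀ ε₂₉ γ₀ (betaPrime510 4 C δ₁) :=
  fun n gs hrg hI k hk => summable_absMoment_of_decay510 h.1 (h.2 n gs hrg hI k hk) 0 1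

/-- **(V-dec-ev) ⟹ (V-absmom)** with `M := β′₅.₁₀`: pointwise-eventual (5.10) per volume gives windows (built from the thresholds, `exists_window_sum_le_of_eventually_le`)
on which the truncated absolute moment is `≤ β′₅.₁₀` at EVERY volume (a fortiori frequently).  The finite-volume letter too sits BELOW its decay twin.
[cite: Balaban1987RG1, (4.37) p.291, (5.10) p.293, (5.42) p.297] -/
theorem recordPvolAbsMomentOnRunsAx_of_pvolDecayEv {γ₀ C δ₁ : ℝ} (h : RecordPvolDecayEvOnRunsAx F a₀ ε₂₉ γ₀ C δ₁) :
    RecordPvolAbsMomentOnRunsAx F a₀ ε₂₉ γ₀ (betaPrime510 4 C δ₁) := by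
  intro n gs hrg hI k hk
  obtain ⟨V, hV⟩ := exists_finset_exhaustion_zd 4
  have hev : ∀ z : Fin 4 → ℤ, ∀ᶠ K in atTop,
      |recordPvolAx F a₀ ε₂₉ k (prefixOf gs k) K 0 1 z| * |(z 0 : ℝ)| * |(z 1 : ℝ)| ≤ C * (l1 z ^ 2 * Real.exp (-δ₁ * l1 z)) :=
    fun z => (h.2 n gs hrg hI k hk z).mono fun K hK => absMomentTerm_le_of_abs_le hK 0 1
  have hm : ∀ z : Fin 4 → ℤ, 0 ≤ C * (l1 z ^ 2 * Real.exp (-δ₁ * l1 z)) := by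
    intro z
    obtain ⟨K, hK⟩ := (hev z).exists
    exact (absMomentTerm_nonneg _ 0 1 z).trans hK
  obtain ⟨W, hW, hsum⟩ := exists_window_sum_le_of_eventually_le V hV hev hm ((majorant_summable h.1 4).mul_left C)
  refine ⟨W, hW, Frequently.of_forall fun K => (hsum K).trans_eq ?_⟩
  rw [tsum_mul_left]
  rfl

/-- ★ **(L-lim) ∧ (V-absmom) ⟹ (L-absmom), RATE-FREE (Fatou through the windows)**: the (1.21) limit pointwise (`tendsto_pvolOf` at `fam := recordTermsAx`) and the
windowed finite-volume bound give the run-uniform absolute second moment of the LIMIT activities with the SAME `M`.  No decay, no rate, no majorant is used.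
[cite: Balaban1987RG1, (1.21)–(1.22) p.264, (5.42) p.297, (0.20) p.256] -/
theorem recordPlimAbsMomentOnRunsAx_of_pvol {γ₀ M : ℝ} (hlim : RecordPolLimitOnRunsAx F a₀ ε₂₉ γ₀) (h : RecordPvolAbsMomentOnRunsAx F a₀ ε₂₉ γ₀ M) :
    RecordPlimAbsMomentOnRunsAx F a₀ ε₂₉ γ₀ M := by
  intro n gs hrg hI k hk
  obtain ⟨W, hW, hM⟩ := h n gs hrg hI k hk
  letI θ := thetaFill F a₀ ε₂₉
  letI := θ.instVβ₁; letI := θ.instVβ₂; letI := θ.instιβ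
  have ht : ∀ z : Fin 4 → ℤ, Tendsto (fun K => |recordPvolAx F a₀ ε₂₉ k (prefixOf gs k) K 0 1 z| * |(z 0 : ℝ)| * |(z 1 : ℝ)|) atTop
      (𝓝 (|recordPlimAx F a₀ ε₂₉ k (prefixOf gs k) 0 1 z| * |(z 0 : ℝ)| * |(z 1 : ℝ)|)) := fun z =>
    ((((continuous_abs.tendsto _).comp
      (tendsto_pvolOf F (recordTermsAx F a₀ ε₂₉) θ.ρ8 θ.bV k (prefixOf gs k) (hlim n gs hrg hI k hk) 0 1 z)).mul_const _).mul_const _)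
  exact summable_and_tsum_le_of_tendsto_of_frequently_sum_le (absMomentTerm_nonneg _ 0 1) (fun K => absMomentTerm_nonneg _ 0 1) ht hW hM

/-- ★ **(L-absmom) ⟹ THE RUN |β| LETTER with `β′ := M`** (level `γ₀ ≤ ½`): ON THE BOX the re-centred β IS the (1.22)-moment of `recordPlimAx`
(`betaOfRecord₁₃Ax_thetaFill_of_mem_box`), dominated by the absolute moment.  This is the ONLY thing the K0ᴬ body reads from NODE O.
[cite: Balaban1987RG1, (1.22) p.264, (5.42) p.297, Thm 3 p.264 («uniformly bounded»)] -/
theorem runAbs_of_recordPlimAbsMomentOnRunsAx {γ₀ M : ℝ} (hγh : γ₀ ≤ 1 / 2) (h : RecordPlimAbsMomentOnRunsAx F a₀ ε₂₉ γ₀ M) :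
    ∀ (n : ℕ) (gs : ℕ → ℝ), RGEqH n (betaOfRecord₁₃Ax F 2 (thetaFill F a₀ ε₂₉)) gs → Step.InInterval γ₀ n gs →
      ∀ k, k ≤ n → |betaOfRecord₁₃Ax F 2 (thetaFill F a₀ ε₂₉) k (prefixOf gs k)| ≤ M := by
  intro n gs hrg hI k hk
  have hv : prefixOf gs k ∈ Box (1 / 2) k := box_mono hγh (prefixOf_mem_box_of_inInterval hI hk)
  rw [betaOfRecord₁₃Ax_thetaFill_of_mem_box F a₀ ε₂₉ hv]
  obtain ⟨hs, hle⟩ := h n gs hrg hI k hk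
  exact (summable_and_abs_secondMoment_le_tsum hs).2.trans hle

/-! ## §4 (route-independent part)  THE JOIN ROAD's MOMENT TWIN shapes `JoinConclMomR` ∕ `JoinConclVolMomR` and their pure-letter comparisons -/

/-- **`JoinConclMomR Tok F` — the radius-uniform JOIN consequent in ABSOLUTE-MOMENT currency**: for `Mc ≥ Mth`, under ▶ PTC-1's bundled thirteen antecedents
`JoinAntecedents Tok F Mc …`, `∃ γ₀ ε₂₉ M, 0 < γ₀ ∧ 0 < ε₂₉ ∧ ∀ γ ≤ γ₀, RecordPlimAbsMomentOnRunsAx F a₀ ε₂₉ γ M` — (L-absmom) alone in place of `JoinConclLimR`'s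
`(1.21) ∧ (5.10)-decay`.  A SHAPE to be supplied (e.g. from a windowed finite-volume moment bound + (1.21) in scope, §2); nothing asserted here.
[cite: Balaban1987RG1, Thm 1 p.259, (1.21)–(1.22) p.264, (4.37) p.291, (5.42) p.297] -/
def JoinConclMomR (Tok : Literature.MathematicalPhysics.QuantumFieldTheory.Balaban1983to89.T4Continuum.T4Family → ℕ → ℝ → Prop)
    (F : Literature.MathematicalPhysics.QuantumFieldTheory.Balaban1983to89.T4Continuum.T4Family) : Prop :=
  ∃ Mth : ℕ, ∀ Mc : ℕ, Mth ≤ Mc → ∀ (j c c₀ c₁ : ℕ) (B₃ B₃' a₀ a₁ : ℝ), JoinAntecedents Tok F Mc j c c₀ c₁ B₃ B₃' a₀ a₁ →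
    ∃ γ₀ ε₂₉ M : ℝ, 0 < γ₀ ∧ 0 < ε₂₉ ∧ ∀ γ : ℝ, γ ≤ γ₀ →
      RecordPlimAbsMomentOnRunsAx F a₀ ε₂₉ γ M

/-- `JoinConclLimR Tok F ⟹ JoinConclMomR Tok F` (`M := β′₅.₁₀(4, C, δ₁)`): the moment-join is WEAKER than ▶ PTC-1's limit-join, for every token.
[cite: Balaban1987RG1, (1.21)–(1.22) p.264, (5.10) p.293, (5.42) p.297] -/
theorem joinConclMomR_of_joinConclLimR {Tok : T4Family → ℕ → ℝ → Prop} {F : T4Family} (hL : JoinConclLimR Tok F) : JoinConclMomR Tok F := by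
  obtain ⟨Mth, hJ⟩ := hL
  refine ⟨Mth, fun Mc hMc j c c₀ c₁ B₃ B₃' a₀ a₁ hA => ?_⟩
  obtain ⟨γ₀, ε₂₉, C, δ₁, hγ₀, hε, hboth⟩ := hJ Mc hMc j c c₀ c₁ B₃ B₃' a₀ a₁ hA
  exact ⟨γ₀, ε₂₉, betaPrime510 4 C δ₁, hγ₀, hε, fun γ hγ => recordPlimAbsMomentOnRunsAx_of_decay F a₀ ε₂₉ (hboth γ hγ).2⟩

/-- **`JoinConclVolMomR Tok F` — the FINITE-VOLUME moment-join**: under the antecedents, `∃ γ₀ ε₂₉ M, 0 < γ₀ ∧ 0 < ε₂₉ ∧ ∀ γ ≤ γ₀, (L-lim) ∧ (V-absmom)` — the (1.21) limit IN SCOPE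
(docket O-11's limit twin) AND windowed absolute moments of the FINITE-VOLUME activities, frequently in the volume; NO rate.  The shape a two-volume limit kit + a per-volume
window bound deliver jointly.  A SHAPE; nothing asserted. [cite: Balaban1987RG1, Thm 1 p.259, (1.20)–(1.21) p.264, (4.37) p.291, (5.42) p.297] -/
def JoinConclVolMomR (Tok : Literature.MathematicalPhysics.QuantumFieldTheory.Balaban1983to89.T4Continuum.T4Family → ℕ → ℝ → Prop)
    (F : Literature.MathematicalPhysics.QuantumFieldTheory.Balaban1983to89.T4Continuum.T4Family) : Prop :=
  ∃ Mth : ℕ, ∀ Mc : ℕ, Mth ≤ Mc → ∀ (j c c₀ c₁ : ℕ) (B₃ B₃' a₀ a₁ : ℝ), JoinAntecedents Tok F Mc j c c₀ c₁ B₃ B₃' a₀ a₁ →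
    ∃ γ₀ ε₂₉ M : ℝ, 0 < γ₀ ∧ 0 < ε₂₉ ∧ ∀ γ : ℝ, γ ≤ γ₀ →
      (Summit.QuantumFields.YangMills.Theorems.K0RecordFormatNames.RecordPolLimitOnRunsAx F a₀ ε₂₉ γ ∧ RecordPvolAbsMomentOnRunsAx F a₀ ε₂₉ γ M)

/-- `JoinConclVolMomR ⟹ JoinConclMomR` (Fatou through the windows, §2; same `M`). [cite: Balaban1987RG1, (1.21)–(1.22) p.264, (5.42) p.297] -/
theorem joinConclMomR_of_joinConclVolMomR {Tok : T4Family → ℕ → ℝ → Prop} {F : T4Family} (hV : JoinConclVolMomR Tok F) : JoinConclMomR Tok F := by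
  obtain ⟨Mth, hJ⟩ := hV
  refine ⟨Mth, fun Mc hMc j c c₀ c₁ B₃ B₃' a₀ a₁ hA => ?_⟩
  obtain ⟨γ₀, ε₂₉, M, hγ₀, hε, hboth⟩ := hJ Mc hMc j c c₀ c₁ B₃ B₃' a₀ a₁ hA
  exact ⟨γ₀, ε₂₉, M, hγ₀, hε, fun γ hγ => recordPlimAbsMomentOnRunsAx_of_pvol F a₀ ε₂₉ (hboth γ hγ).1 (hboth γ hγ).2⟩


end Summit.QuantumFields.YangMills.Theorems.K0AxMomentRoad

end
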